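import Summits.BirchSwinnertonDyer.Rank1Residual.X11b.AnticyclotomicSelmerDual
import Literature.NumberTheory.EllipticCurves.PeriodIndexCorestrictionLocal
import Literature.NumberTheory.EllipticCurves.Isogeny
import HarnessLib

/-!
# Route `SchneiderFreeAdditiveX3` (rung K1 door), crux `GordTwoBranchIMC` (item stmt-BirchSwinnertonDyer-19177):
# FUNCTORIALITY of Castella's anticyclotomic Selmer group `Sel_𝔭^Σ(K_∞, E[p^∞])` and of its `Λ`-dual
# `X_ac` in the coefficient module — the COMPARISON MAP along an isogeny

Cell `bsd-schneider-ideate`, seat `bsd-schneider-door-c3` (prover, generation 4). HONEST FRAMING: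
Galois-cohomology plumbing (kernel-checked, unconditional): NOTHING is asserted about BSD; the crux
`GordTwoBranchIMC` (Keller–Yin arXiv:2410.23241 Thm. 3.5.1 at the frame — PREPRINT) stays OPEN.
`--supports` material for item 19177. This file supplies the «ONE comparison map» that the lattice
transport of `Theorems/SchneiderFreeAdditiveX3BranchIMCLatticeTransport.lean` asks for (finding G2
of this seat's hypothesis audit): with it, the door direction `Ch_Λ(X_ac)·R₀⟦T⟧ ⊆ (L)` read on ONE
curve of a `K`-isogeny class with `μ = 0` (Keller–Yin's lattice) passes to every `p`-power-isogenous
curve.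

* §1 (any field `K`, any closed `H ≤ Γ_K`, discrete `Γ_K`-modules `M → M'`). A `Γ_K`-equivariant
  `g : M →+ M'` induces `coeffMapH1 H g : H¹(H, M) → H¹(H, M')` (`resH1Hom` along `(id_H, g)`); it
  commutes with restriction to subgroups (`resOfLe_comp_coeffMapH1`), with the conjugation action
  (`conjH1_comp_coeffMapH1`) and with the strict local map of the strict datum
  (`strictMap_comp_coeffMapH1`), is functorial (`coeffMapH1_comp`) and sends `n • id_M` to `n • id`
  (`coeffMapH1_nsmul_apply`, on cocycles). Hence it maps `Sel_𝔭^Σ(L, M)` into `Sel_𝔭^Σ(L, M')`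
  (`coeffMapH1_mem_selmerOver`).
* §2 (two curves `W₁, W₂ /K`, one frame `(κ, 𝔭, Σ, γ)`). For a `Γ_K`-equivariant
  `g : W₁[p^∞] →+ W₂[p^∞]`: the induced `selmerAcMap g : Sel(W₁) →+ Sel(W₂)` and its TRANSPOSE
  `xacComap g : X_ac(W₂) →ₗ[Λ] X_ac(W₁)` — `Λ`-LINEAR for the constructed `ℤ_p⟦T⟧`-structures
  (`T ↦ conj_γ − 1` commutes with `g`; `IsLocNil.smulFun` computed with common truncations).
* §3 (an isogeny `φ : W₁ → W₂` over `K` with a `p`-power quasi-inverse `ψ`: `ψ ∘ φ = [p^m]`,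
  `φ ∘ ψ = [p^m]` on geometric points). The restrictions to `p`-primary torsion are equivariant, and
  the transpose `xacComap` of `φ` has kernel and cokernel killed by `p^m`
  (`xacComap_ker_smul`, `xacComap_coker_smul`) — exactly the hypotheses of
  `charIdeal_le_of_linearMap_of_muInvariant_eq_zero'` / `xac_charIdeal_map_le_transport'`.

What is NOT here: base change of a `ℚ`-isogeny to `K` as an `Isogeny (W₁.baseChange K) (W₂.baseChange K)`
(the door's curves are `ℚ`-curves base-changed), the existence of the `p`-power quasi-inverse (for an
isogeny of degree `p^m` this is the dual isogeny, tree `Isogeny.exists_dual_elliptic`, plus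
`φ ∘ φ̂ = [p^m]`), and finite generation / torsion of `X_ac` (control).

References: Serre, *Galois Cohomology* I.§2.4–2.5; Greenberg 1989 §1; Castella 2018 §2.1–2.2
(arXiv:1704.06608 p. 5); Keller–Yin arXiv:2410.23241 §3.3 p. 17 (the lattice convention).
-/

noncomputable section

open scoped Classical

open NumberField IsDedekindDomain Field PowerSeries
  Literature.NumberTheory.EllipticCurves
  Literature.NumberTheory.EllipticCurves.GreenbergSelmer
  Literature.NumberTheory.GaloisRepresentations
  Summit.BirchSwinnertonDyer.Rank1Residual.X11b.AcSelmer

set_option linter.dupNamespace false -- D-0017 layout: summit = sub-problem (mandated namespace)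
set_option autoImplicit false

universe u

namespace Summit.BirchSwinnertonDyer.BirchSwinnertonDyer.Theorems.SchneiderFree

/-! ## §1 Coefficient functoriality of `H¹(H, ·)`, of the local conditions, and of `Sel_𝔭^Σ(L, ·)` -/

section Coeff

variable {K : Type u} [Field K]
variable {M M' M'' : Type u} [AddCommGroup M] [DistribMulAction (absoluteGaloisGroup K) M]
  [TopologicalSpace M] [DiscreteTopology M] [AddCommGroup M']
  [DistribMulAction (absoluteGaloisGroup K) M'] [TopologicalSpace M'] [DiscreteTopology M']
  [AddCommGroup M''] [DistribMulAction (absoluteGaloisGroup K) M''] [TopologicalSpace M'']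
  [DiscreteTopology M'']

/-- **`H¹(H, g) : H¹(H, M) → H¹(H, M')`** for a `Γ_K`-equivariant `g : M →+ M'` and a subgroup
`H ≤ Γ_K`: the map of the compatible pair `(id_H, g)`. [folklore] -/
def coeffMapH1 (H : Subgroup (absoluteGaloisGroup K)) (g : M →+ M')
    (hg : ∀ (σ : absoluteGaloisGroup K) (m : M), g (σ • m) = σ • g m) :
    subgroupH1 H M →+ subgroupH1 H M' :=
  resH1Hom (ContinuousMonoidHom.id H) g fun x m ↦ hg x m

variable (H : Subgroup (absoluteGaloisGroup K)) (g : M →+ M')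
  (hg : ∀ (σ : absoluteGaloisGroup K) (m : M), g (σ • m) = σ • g m)

/-- `H¹(H, g)` commutes with restriction to a subgroup `H₀ ≤ H` (both composites are the map of the
pair `(H₀ ↪ H, g)`). [folklore] -/
theorem resOfLe_comp_coeffMapH1 {H₀ : Subgroup (absoluteGaloisGroup K)} (h : H₀ ≤ H) :
    (resOfLe M' h).comp (coeffMapH1 H g hg) = (coeffMapH1 H₀ g hg).comp (resOfLe M h) := by
  rw [coeffMapH1, coeffMapH1, resOfLe, resOfLe, resH1Hom_comp, resH1Hom_comp]
  exact resH1Hom_congr (by ext; rfl) (by ext; rfl) _ _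

/-- `H¹(H, g)` commutes with the conjugation action of `Γ_K` on `H¹(H, ·)` (`H` normal): both
composites are the map of the pair `(h ↦ σ⁻¹hσ, m ↦ σ • g m = g (σ • m))`. [folklore] -/
theorem conjH1_comp_coeffMapH1 [H.Normal] (σ : absoluteGaloisGroup K) :
    (conjH1 H M' σ).comp (coeffMapH1 H g hg) = (coeffMapH1 H g hg).comp (conjH1 H M σ) := by
  rw [coeffMapH1, conjH1, conjH1, resH1Hom_comp, resH1Hom_comp]
  exact resH1Hom_congr (by ext; rfl) (by ext m; simp [hg]) _ _

/-- Pointwise form of `conjH1_comp_coeffMapH1`. [folklore] -/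
theorem conjH1_coeffMapH1 [H.Normal] (σ : absoluteGaloisGroup K) (c : subgroupH1 H M) :
    conjH1 H M' σ (coeffMapH1 H g hg c) = coeffMapH1 H g hg (conjH1 H M σ c) := by
  have h := conjH1_comp_coeffMapH1 H g hg σ
  exact DFunLike.congr_fun h c

/-- `coeffMapH1` only depends on the map `g` (proof-irrelevant congruence). [folklore] -/
theorem coeffMapH1_congr {g g' : M →+ M'} (h : g = g')
    (hg : ∀ (σ : absoluteGaloisGroup K) (m : M), g (σ • m) = σ • g m)
    (hg' : ∀ (σ : absoluteGaloisGroup K) (m : M), g' (σ • m) = σ • g' m) :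
    coeffMapH1 H g hg = coeffMapH1 H g' hg' := by
  subst h; rfl

/-- Functoriality: `H¹(H, g' ∘ g) = H¹(H, g') ∘ H¹(H, g)`. [folklore] -/
theorem coeffMapH1_comp (g' : M' →+ M'')
    (hg' : ∀ (σ : absoluteGaloisGroup K) (m : M'), g' (σ • m) = σ • g' m) :
    (coeffMapH1 H g' hg').comp (coeffMapH1 H g hg) =
      coeffMapH1 H (g'.comp g) (fun σ m ↦ by simp [hg, hg']) := by
  unfold coeffMapH1
  rw [resH1Hom_comp]
  exact resH1Hom_congr (by ext; rfl) rfl _ _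

omit [TopologicalSpace M] [DiscreteTopology M] in
/-- Multiplication by `n` is `Γ_K`-equivariant. [folklore] -/
theorem nsmul_equivariant (n : ℕ) (σ : absoluteGaloisGroup K) (m : M) :
    DistribSMul.toAddMonoidHom M n (σ • m) = σ • DistribSMul.toAddMonoidHom M n m := by
  simpa only [DistribSMul.toAddMonoidHom_apply] using
    (map_nsmul (DistribSMul.toAddMonoidHom M σ) n m).symm

/-- **`H¹(H, n • id_M) = n • id`**: on a cocycle `f` the map of the pair `(id, n • id)` is `n • f`
(`resH1Hom_oneCocycleClass`), and the class map is additive. [folklore] -/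
theorem coeffMapH1_nsmul_apply (n : ℕ) (c : subgroupH1 H M) :
    coeffMapH1 H (DistribSMul.toAddMonoidHom M n) (nsmul_equivariant n) c = n • c := by
  obtain ⟨f, rfl⟩ := oneCocycleClass_surjective _ c
  have key : contOneCocycles.pullback (ContinuousMonoidHom.id H)
      (resHomOfEquivariant (ContinuousMonoidHom.id H) (DistribSMul.toAddMonoidHom M n)
        fun x m ↦ nsmul_equivariant n (x : absoluteGaloisGroup K) m) f = n • f := by
    apply Subtype.ext
    ext x
    rw [pullback_resHomOfEquivariant_apply]
    simp
  calc coeffMapH1 H (DistribSMul.toAddMonoidHom M n) (nsmul_equivariant n)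
        (oneCocycleClass (discreteTopRep H M) f)
      = oneCocycleClass (discreteTopRep H M) (contOneCocycles.pullback (ContinuousMonoidHom.id H)
          (resHomOfEquivariant (ContinuousMonoidHom.id H) (DistribSMul.toAddMonoidHom M n)
            fun x m ↦ nsmul_equivariant n (x : absoluteGaloisGroup K) m) f) :=
        resH1Hom_oneCocycleClass _ _ _ f
    _ = oneCocycleClass (discreteTopRep H M) (n • f) := by rw [key]
    _ = n • oneCocycleClass (discreteTopRep H M) f := map_nsmul (oneCocycleClassₗ _) n f

variable [NumberField K]

/-- `H¹(H, g)` commutes with the STRICT local map of the strict datum `M⁺ = 0` at `v`: the induced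
map on `H¹(H ⊓ D_v, M ⧸ 0)` is the map of the pair `(id, gq)` with `gq : M ⧸ 0 → M' ⧸ 0` induced by
`g`. [folklore] -/
theorem strictMap_comp_coeffMapH1 (v : HeightOneSpectrum (𝓞 K)) :
    ∃ gq : discreteH1 (decompIn H v) (strictDatum M v).Gr →+
        discreteH1 (decompIn H v) (strictDatum M' v).Gr,
      ((strictDatum M' v).strictMap H).comp (coeffMapH1 H g hg) =
        gq.comp ((strictDatum M v).strictMap H) := by
  -- the map on the graded pieces `M ⧸ 0 → M' ⧸ 0`
  let gGr : (strictDatum M v).Gr →+ (strictDatum M' v).Gr :=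
    QuotientAddGroup.map (strictDatum M v).plus (strictDatum M' v).plus g fun m hm ↦ by
      change m ∈ (⊥ : AddSubgroup M) at hm
      change g m ∈ (⊥ : AddSubgroup M')
      rw [AddSubgroup.mem_bot] at hm ⊢
      rw [hm, map_zero]
  have hgGr : ∀ m : M, gGr ((strictDatum M v).grMk m) = (strictDatum M' v).grMk (g m) :=
    fun _ ↦ rfl
  have hcompat : ∀ (x : decompIn H v) (q : (strictDatum M v).Gr),
      gGr ((ContinuousMonoidHom.id (decompIn H v)) x • q) = x • gGr q := by
    intro x q
    obtain ⟨m, rfl⟩ := (strictDatum M v).grMk_surjective q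
    change gGr ((x : decomp v) • (strictDatum M v).grMk m) =
      (x : decomp v) • gGr ((strictDatum M v).grMk m)
    rw [LocalDatum.smul_grMk, hgGr, hgGr, LocalDatum.smul_grMk, hg]
  refine ⟨resH1Hom (ContinuousMonoidHom.id (decompIn H v)) gGr hcompat, ?_⟩
  rw [coeffMapH1, LocalDatum.strictMap, LocalDatum.strictMap, resH1Hom_comp, resH1Hom_comp]
  exact resH1Hom_congr (by ext; rfl) (by ext m; exact (hgGr m).symm) _ _

variable {H g hg} in
omit [NumberField K] in
/-- Kernels of restriction are preserved: if `res_{H₀} c = 0` then `res_{H₀} (H¹(g) c) = 0`. [folklore] -/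
theorem resOfLe_coeffMapH1_eq_zero {H₀ : Subgroup (absoluteGaloisGroup K)} (h : H₀ ≤ H)
    {c : subgroupH1 H M} (hc : resOfLe M h c = 0) : resOfLe M' h (coeffMapH1 H g hg c) = 0 := by
  have e := DFunLike.congr_fun (resOfLe_comp_coeffMapH1 H g hg h) c
  simp only [AddMonoidHom.comp_apply] at e
  rw [e, hc, map_zero]

/-- **`H¹(H, g)` maps `Sel_𝔭^Σ(L, M)` into `Sel_𝔭^Σ(L, M')`** (`L = K̄^H`): every local condition of
Castella's Selmer group — triviality above the finite `w ∉ Σ`, `w ∤ p`, above the infinite places,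
and the strict condition above `𝔭`, each imposed on all `Γ_K`-conjugates — is a kernel condition
functorial in the coefficients. [cite: Castella2018, Def. 2.2 (arXiv:1704.06608 p. 5) (shape only)] -/
theorem coeffMapH1_mem_selmerOver [H.Normal] {p : ℕ} {𝔭 : HeightOneSpectrum (𝓞 K)}
    {S : Set (HeightOneSpectrum (𝓞 K))} {c : subgroupH1 H M} (hc : c ∈ selmerOver H M p 𝔭 S) :
    coeffMapH1 H g hg c ∈ selmerOver H M' p 𝔭 S := by
  rw [mem_selmerOver_iff] at hc ⊢
  obtain ⟨hA, hI, hS⟩ := hc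
  refine ⟨fun v hv hvS σ ↦ ?_, fun w σ ↦ ?_, fun σ ↦ ?_⟩
  · rw [conjH1_coeffMapH1]
    exact resOfLe_coeffMapH1_eq_zero _ (hA v hv hvS σ)
  · rw [conjH1_coeffMapH1]
    exact resOfLe_coeffMapH1_eq_zero _ (hI w σ)
  · rw [conjH1_coeffMapH1, LocalDatum.mem_strictKer_iff]
    obtain ⟨gq, hgq⟩ := strictMap_comp_coeffMapH1 H g hg 𝔭
    have e := DFunLike.congr_fun hgq (conjH1 H M σ c)
    simp only [AddMonoidHom.comp_apply] at e
    rw [e, (LocalDatum.mem_strictKer_iff _ _ _).mp (hS σ), map_zero]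

end Coeff

/-! ## §2 The induced map on `Sel_𝔭^Σ(K_∞, ·)` for two curves over `K`, and its `Λ`-linear transpose on `X_ac` -/

section Curves

variable {K : Type u} [Field K] [NumberField K] {p : ℕ} [Fact p.Prime]
  (W₁ W₂ : WeierstrassCurve K) (κ : ZpExtension K p) (𝔭 : HeightOneSpectrum (𝓞 K))
  (S : Set (HeightOneSpectrum (𝓞 K)))
  (g : W₁.geomPrimaryTorsion p →+ W₂.geomPrimaryTorsion p)
  (hg : ∀ (σ : absoluteGaloisGroup K) (m : W₁.geomPrimaryTorsion p), g (σ • m) = σ • g m)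

/-- **`Sel(g) : Sel_𝔭^Σ(K_∞, W₁[p^∞]) → Sel_𝔭^Σ(K_∞, W₂[p^∞])`** induced by a `Γ_K`-equivariant map of
the `p`-primary torsion modules. [cite: Castella2018, Def. 2.2 (arXiv:1704.06608 p. 5) (shape only)] -/
def selmerAcMap : selmerAc W₁ p κ 𝔭 S →+ selmerAc W₂ p κ 𝔭 S :=
  ((coeffMapH1 κ.kerSubgroup g hg).comp (selmerAc W₁ p κ 𝔭 S).subtype).codRestrict _ fun c ↦
    coeffMapH1_mem_selmerOver κ.kerSubgroup g hg c.2

/-- Unfolding `selmerAcMap` on underlying classes. [folklore] -/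
@[simp]
theorem coe_selmerAcMap_apply (c : selmerAc W₁ p κ 𝔭 S) :
    ((selmerAcMap W₁ W₂ κ 𝔭 S g hg c : selmerAc W₂ p κ 𝔭 S) : W₂.subgroupH1 p κ.kerSubgroup) =
      coeffMapH1 κ.kerSubgroup g hg c :=
  rfl

/-- `Sel(g)` commutes with the `Γ`-action `conj_γ`. [folklore] -/
theorem selmerAcMap_conjSelmerAc (γ : absoluteGaloisGroup K) (c : selmerAc W₁ p κ 𝔭 S) :
    selmerAcMap W₁ W₂ κ 𝔭 S g hg (conjSelmerAc W₁ p κ 𝔭 S γ c) =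
      conjSelmerAc W₂ p κ 𝔭 S γ (selmerAcMap W₁ W₂ κ 𝔭 S g hg c) := by
  apply Subtype.ext
  rw [coe_selmerAcMap_apply, coe_conjSelmerAc_apply, coe_conjSelmerAc_apply, coe_selmerAcMap_apply]
  exact (conjH1_coeffMapH1 κ.kerSubgroup g hg γ (c : W₁.subgroupH1 p κ.kerSubgroup)).symm

/-- `Sel(g)` commutes with every power of `conj_γ − 1` (the endomorphism through which `T` acts).
[folklore] -/
theorem selmerAcMap_sub_one_pow_apply (γ : absoluteGaloisGroup K) (i : ℕ) (c : selmerAc W₁ p κ 𝔭 S) :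
    selmerAcMap W₁ W₂ κ 𝔭 S g hg (((conjSelmerAc W₁ p κ 𝔭 S γ - 1) ^ i) c) =
      ((conjSelmerAc W₂ p κ 𝔭 S γ - 1) ^ i) (selmerAcMap W₁ W₂ κ 𝔭 S g hg c) := by
  induction i generalizing c with
  | zero => simp
  | succ i ih =>
    rw [pow_succ, pow_succ, AddMonoid.End.coe_mul, AddMonoid.End.coe_mul, Function.comp_apply,
      Function.comp_apply, ih, IwasawaDual.End_sub_apply, IwasawaDual.End_sub_apply,
      AddMonoid.End.one_apply, AddMonoid.End.one_apply, map_sub, selmerAcMap_conjSelmerAc]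

variable (γ : absoluteGaloisGroup K) [hγ : Fact (κ.IsTopGenerator γ)]

/-- **The transpose `X_ac(g) : X_ac^Σ(W₂[p^∞]) → X_ac^Σ(W₁[p^∞])`, `x ↦ x ∘ Sel(g)`, is `Λ`-LINEAR**
for the constructed `Λ = ℤ_p⟦T⟧`-module structures (`T ↦ conj_γ − 1` on both sides): the truncated
action `evalT` of `f ∈ Λ` may be computed on both sides with the truncation parameters of
`c ∈ Sel(W₁)` (they are admissible for `Sel(g) c` because `Sel(g)` commutes with `conj_γ − 1` and is
additive). [cite: Castella2018, §2.1–2.2 (arXiv:1704.06608 p. 5) (the Λ-module X_ac; shape only)] -/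
def xacComap : XAc W₂ p κ 𝔭 S γ →ₗ[IwasawaAlgebra p] XAc W₁ p κ 𝔭 S γ where
  toFun x := (x : selmerAc W₂ p κ 𝔭 S →+ AddCircle (1 : ℚ)).comp (selmerAcMap W₁ W₂ κ 𝔭 S g hg)
  map_add' x y := DFunLike.ext _ _ fun c ↦ rfl
  map_smul' f x := by
    refine DFunLike.ext _ _ fun c ↦ ?_
    have h₁ := isLocNil_conjSelmerAc_sub_one W₁ p κ 𝔭 S hγ.out
    have h₂ := isLocNil_conjSelmerAc_sub_one W₂ p κ 𝔭 S hγ.out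
    -- truncation parameters of `c` are admissible for `Sel(g) c`
    have hN : ((conjSelmerAc W₂ p κ 𝔭 S γ - 1) ^ h₁.tN c) (selmerAcMap W₁ W₂ κ 𝔭 S g hg c) = 0 := by
      rw [← selmerAcMap_sub_one_pow_apply, h₁.tN_spec, map_zero]
    have hk : p ^ h₁.tk c • selmerAcMap W₁ W₂ κ 𝔭 S g hg c = 0 := by
      rw [← map_nsmul, h₁.tk_spec, map_zero]
    change h₂.smulFun f x (selmerAcMap W₁ W₂ κ 𝔭 S g hg c) =
      h₁.smulFun f ((x : selmerAc W₂ p κ 𝔭 S →+ AddCircle (1 : ℚ)).comp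
        (selmerAcMap W₁ W₂ κ 𝔭 S g hg)) c
    rw [h₂.smulFun_apply f x hN hk, h₁.smulFun_apply f _ (h₁.tN_spec c) (h₁.tk_spec c),
      IwasawaDual.evalT_def, IwasawaDual.evalT_def]
    refine Finset.sum_congr rfl fun i _ ↦ ?_
    rw [AddMonoidHom.comp_apply, selmerAcMap_sub_one_pow_apply]

/-- Unfolding `xacComap`: `X_ac(g) x = x ∘ Sel(g)`. [folklore] -/
theorem xacComap_apply (x : XAc W₂ p κ 𝔭 S γ) (c : selmerAc W₁ p κ 𝔭 S) :
    xacComap W₁ W₂ κ 𝔭 S g hg γ x c = x (selmerAcMap W₁ W₂ κ 𝔭 S g hg c) :=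
  rfl

variable {W₁ κ 𝔭 S γ} in
/-- **`(p^m · x)(c) = x(p^m · c)` on `X_ac`**: the constants of `Λ` act through `ℤ_p → ℤ/p^k`
(`XAc.C_smul_apply`), and `(p^m mod p^k) · c = p^m · c` for `p^k c = 0`. [cite: Lang1990, Ch. 5 §1] -/
theorem C_pow_smul_apply (m : ℕ) (x : XAc W₁ p κ 𝔭 S γ) (c : selmerAc W₁ p κ 𝔭 S) :
    ((PowerSeries.C (p : ℤ_[p]) : IwasawaAlgebra p) ^ m • x) c = x (p ^ m • c) := by
  obtain ⟨k, hk⟩ := (isLocNil_conjSelmerAc_sub_one W₁ p κ 𝔭 S hγ.out).torsion c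
  rw [← map_pow, ← Nat.cast_pow, XAc.C_smul_apply W₁ p κ 𝔭 S γ _ x hk, map_natCast,
    ZMod.val_natCast, ← map_nsmul, IwasawaDual.mod_smul_eq hk]

end Curves

/-! ## §3 Along an isogeny with a `p`-power quasi-inverse: kernel and cokernel of the transpose are killed by `p^m` -/

section Isogeny

variable {K : Type u} [Field K] {p : ℕ} {W₁ W₂ : WeierstrassCurve K}

/-- The restriction of an isogeny `φ : W₁ → W₂` over `K` to the `p`-primary torsion
`W₁[p^∞] → W₂[p^∞]` (a homomorphism preserves `p`-power torsion). [folklore] -/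
def isogenyPrimaryMap (φ : WeierstrassCurve.Isogeny W₁ W₂) :
    W₁.geomPrimaryTorsion p →+ W₂.geomPrimaryTorsion p :=
  (φ.toAddMonoidHom.comp (W₁.geomPrimaryTorsion p).subtype).codRestrict _ fun P ↦ by
    obtain ⟨n, hn⟩ := AddCommGroup.mem_primaryComponent.mp P.2
    refine AddCommGroup.mem_primaryComponent.mpr ⟨n, ?_⟩
    rw [AddMonoidHom.coe_comp, AddSubgroup.coe_subtype, Function.comp_apply, ← map_nsmul, hn,
      map_zero]

/-- Unfolding `isogenyPrimaryMap` on underlying points. [folklore] -/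
@[simp]
theorem coe_isogenyPrimaryMap (φ : WeierstrassCurve.Isogeny W₁ W₂) (P : W₁.geomPrimaryTorsion p) :
    ((isogenyPrimaryMap (p := p) φ P : W₂.geomPrimaryTorsion p) : W₂.geomPoints) = φ P :=
  rfl

/-- The restriction is `Γ_K`-equivariant (an isogeny over `K` commutes with `Γ_K`). [folklore] -/
theorem isogenyPrimaryMap_smul (φ : WeierstrassCurve.Isogeny W₁ W₂) (σ : absoluteGaloisGroup K)
    (P : W₁.geomPrimaryTorsion p) :
    isogenyPrimaryMap (p := p) φ (σ • P) = σ • isogenyPrimaryMap (p := p) φ P :=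
  Subtype.ext (by simp [WeierstrassCurve.Isogeny.map_smul])

variable [NumberField K] [Fact p.Prime] (κ : ZpExtension K p) (𝔭 : HeightOneSpectrum (𝓞 K))
  (S : Set (HeightOneSpectrum (𝓞 K))) (γ : absoluteGaloisGroup K) [hγ : Fact (κ.IsTopGenerator γ)]
  (φ : WeierstrassCurve.Isogeny W₁ W₂) (ψ : WeierstrassCurve.Isogeny W₂ W₁) (m : ℕ)

/-- `Sel(ψ) ∘ Sel(φ) = p^m` on `Sel_𝔭^Σ(K_∞, W₁[p^∞])` when `ψ ∘ φ = [p^m]`. [folklore] -/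
theorem selmerAcMap_selmerAcMap_eq_nsmul (hψφ : ∀ P : W₁.geomPoints, ψ (φ P) = (p ^ m : ℕ) • P)
    (c : selmerAc W₁ p κ 𝔭 S) :
    selmerAcMap W₂ W₁ κ 𝔭 S (isogenyPrimaryMap ψ) (isogenyPrimaryMap_smul ψ)
      (selmerAcMap W₁ W₂ κ 𝔭 S (isogenyPrimaryMap φ) (isogenyPrimaryMap_smul φ) c) = p ^ m • c := by
  apply Subtype.ext
  rw [coe_selmerAcMap_apply, coe_selmerAcMap_apply, AddSubgroupClass.coe_nsmul]
  have hcomp : (isogenyPrimaryMap (p := p) ψ).comp (isogenyPrimaryMap (p := p) φ) =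
      DistribSMul.toAddMonoidHom (W₁.geomPrimaryTorsion p) (p ^ m) := by
    ext P
    simp [hψφ]
  have e := DFunLike.congr_fun (coeffMapH1_comp κ.kerSubgroup (isogenyPrimaryMap (p := p) φ)
    (isogenyPrimaryMap_smul φ) (isogenyPrimaryMap (p := p) ψ) (isogenyPrimaryMap_smul ψ))
    (c : W₁.subgroupH1 p κ.kerSubgroup)
  simp only [AddMonoidHom.comp_apply] at e
  rw [e, coeffMapH1_congr κ.kerSubgroup hcomp _ (nsmul_equivariant (p ^ m)),
    coeffMapH1_nsmul_apply]

/-- **The kernel of `X_ac(φ) : X_ac(W₂) → X_ac(W₁)` is killed by `p^m`** (`φ ∘ ψ = [p^m]`): if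
`x ∘ Sel(φ) = 0` then `(p^m x)(c) = x(p^m c) = x(Sel(φ)(Sel(ψ) c)) = 0`. [folklore] -/
theorem xacComap_ker_smul (hφψ : ∀ Q : W₂.geomPoints, φ (ψ Q) = (p ^ m : ℕ) • Q)
    (x : XAc W₂ p κ 𝔭 S γ)
    (hx : xacComap W₁ W₂ κ 𝔭 S (isogenyPrimaryMap φ) (isogenyPrimaryMap_smul φ) γ x = 0) :
    (PowerSeries.C (p : ℤ_[p]) : IwasawaAlgebra p) ^ m • x = 0 := by
  refine DFunLike.ext _ _ fun c ↦ ?_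
  rw [C_pow_smul_apply, ← selmerAcMap_selmerAcMap_eq_nsmul κ 𝔭 S ψ φ m hφψ c, ← xacComap_apply,
    hx]
  rfl

/-- **The cokernel of `X_ac(φ)` is killed by `p^m`** (`ψ ∘ φ = [p^m]`): `p^m y = y ∘ p^m =
y ∘ Sel(ψ) ∘ Sel(φ) = X_ac(φ)(y ∘ Sel(ψ))`. [folklore] -/
theorem xacComap_coker_smul (hψφ : ∀ P : W₁.geomPoints, ψ (φ P) = (p ^ m : ℕ) • P)
    (y : XAc W₁ p κ 𝔭 S γ) :
    ∃ x : XAc W₂ p κ 𝔭 S γ, (PowerSeries.C (p : ℤ_[p]) : IwasawaAlgebra p) ^ m • y =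
      xacComap W₁ W₂ κ 𝔭 S (isogenyPrimaryMap φ) (isogenyPrimaryMap_smul φ) γ x := by
  refine ⟨xacComap W₂ W₁ κ 𝔭 S (isogenyPrimaryMap ψ) (isogenyPrimaryMap_smul ψ) γ y, ?_⟩
  refine DFunLike.ext _ _ fun c ↦ ?_
  rw [C_pow_smul_apply, xacComap_apply, xacComap_apply,
    selmerAcMap_selmerAcMap_eq_nsmul κ 𝔭 S φ ψ m hψφ c]

end Isogeny

end Summit.BirchSwinnertonDyer.BirchSwinnertonDyer.Theorems.SchneiderFree

end
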